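import Mathlib
import Summits.NavierStokesRegularity.FluidComputer.TransportGalerkinLevelExistence
import Summits.NavierStokesRegularity.FluidComputer.TransportGalerkinKillLevels
import Summits.NavierStokesRegularity.FluidComputer.TransportGalerkinAbc
import HarnessLib

/-!
# Galerkin limit of the transport model, XVIII: the forced-ABC KILL from the certificates and the basin data ALONE (instab g19, cell `ns-blowup`, 2026-08-27)

HONEST FRAMING (human ruling D-0035): nothing here is a claim about Navier–Stokes blow-up.
WHAT THIS IS NOT: not NS — a MODEL theorem schema about the forced-ABC perturbation equation on
`𝕋³`; its load-bearing inputs are the Lyapunov certificates of record (interval stage not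
commissioned) and the certified X0 eigenvalue; no number or census word moves.

PURPOSE. The KILL twin of part XVI. `TransportGalerkinKillLevels.decay_two_nsField_of_levels` reads the
KILL word (`‖w t‖ ≤ 2 ε e^{λt}`, `ω < 2λ ≤ 0`, `ω₁ ≤ λ`, seed in the basin) from the certificates, the
basin data and the Galerkin levels of the seed as `C¹` solutions of the finite-dimensional ODE keeping
the clauses; part XV constructs those levels. Composed for forced ABC (`decay_two_abc_final`): for a
rapidly decreasing, Leray-fixed, real, divergence-free seed `x` with `√(M/m)‖x‖ < ε`, `4Cε < 1`, the
certificate objects and inequalities at levels `≥ K` (g18's list verbatim) and `ν > 0`, EVERY true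
solution `w` of the model from `x` read in the class with a uniform polynomial tail of scaled order `6`
(+ clauses) obeys `‖w t‖ ≤ 2 ε e^{λt}` on the window. NO residence / box / radii / `H²` bound / Galerkin
data among the hypotheses.
-/

noncomputable section

open scoped ENNReal NNReal ComplexConjugate InnerProductSpace
open Set Filter Topology

namespace Summit.NavierStokesRegularity.FluidComputer.TransportGalerkinAbcKillFinal

open RCLike MeasureTheory UnitAddTorus
open Literature.Analysis.FunctionSpaces Literature.Analysis.FunctionSpaces.Lattice
open Literature.Analysis.FunctionSpaces.Torus Literature.Analysis.FunctionSpaces.EuclideanSpace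
open Literature.Analysis.ODE Literature.Analysis.FluidPDE
open Summit.NavierStokesRegularity.FluidComputer.TransportGalerkin
open Summit.NavierStokesRegularity.FluidComputer.TransportGalerkinBox
open Summit.NavierStokesRegularity.FluidComputer.TransportGalerkinEigen
open Summit.NavierStokesRegularity.FluidComputer.TransportGalerkinAbc
open Summit.NavierStokesRegularity.FluidComputer.TransportGalerkinInvariance
open Summit.NavierStokesRegularity.FluidComputer.TransportGalerkinLevelSubspace
open Summit.NavierStokesRegularity.FluidComputer.TransportGalerkinLevelExistence
open Summit.NavierStokesRegularity.FluidComputer.TransportGalerkinKillLevels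
open Summit.NavierStokesRegularity.FluidComputer.ConvectiveProductLawBooking

/-- **KILL for the forced-ABC model from the certificates and the basin data alone**
(`decay_two_abc_final`; see the module docstring). -/
theorem decay_two_abc_final (K : ℕ) (A B C : ℝ) {ν : ℝ} (hν : 0 < ν) {T : ℝ} (hT : 0 ≤ T)
    {x : lp (fun _ : (Fin 3 → ℤ) => EuclideanSpace ℂ (Fin 3)) 2} (hxr : RapidDecay (⇑x))
    (hxfix : ∀ k, lerayCLM k (x k) = x k)
    (hxreal : ∀ (j : Fin 3) (k : Fin 3 → ℤ), (EuclideanSpace.proj j : EuclideanSpace ℂ (Fin 3) →L[ℂ] ℂ) (x (-k)) =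
      conj ((EuclideanSpace.proj j : EuclideanSpace ℂ (Fin 3) →L[ℂ] ℂ) (x k)))
    (hxdiv : ∀ k : Fin 3 → ℤ, ∑ j, ((k j : ℤ) : ℂ) * (EuclideanSpace.proj j : EuclideanSpace ℂ (Fin 3) →L[ℂ] ℂ) (x k) = 0)
    {μt : ℝ}
    {G₁ G₂ G : lp (fun _ : (Fin 3 → ℤ) => EuclideanSpace ℂ (Fin 3)) 2 →L[ℝ]
      lp (fun _ : (Fin 3 → ℤ) => EuclideanSpace ℂ (Fin 3)) 2}
    (hG₁ : ∀ x y : lp (fun _ : (Fin 3 → ℤ) => EuclideanSpace ℂ (Fin 3)) 2, ⟪G₁ x, y⟫_ℂ = ⟪x, G₁ y⟫_ℂ)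
    (hG₂ : ∀ x y : lp (fun _ : (Fin 3 → ℤ) => EuclideanSpace ℂ (Fin 3)) 2, ⟪G₂ x, y⟫_ℂ = ⟪x, G₂ y⟫_ℂ)
    (hG : ∀ x y : lp (fun _ : (Fin 3 → ℤ) => EuclideanSpace ℂ (Fin 3)) 2, ⟪G x, y⟫_ℂ = ⟪x, G y⟫_ℂ)
    (hG₁P : ∀ n, ∀ w z : lp (fun _ : (Fin 3 → ℤ) => EuclideanSpace ℂ (Fin 3)) 2,
      ⟪G₁ w, cubeProj (n + K) z⟫_ℂ = ⟪G₁ (cubeProj (n + K) w), z⟫_ℂ)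
    (hG₂P : ∀ n, ∀ w z : lp (fun _ : (Fin 3 → ℤ) => EuclideanSpace ℂ (Fin 3)) 2,
      ⟪G₂ w, cubeProj (n + K) z⟫_ℂ = ⟪G₂ (cubeProj (n + K) w), z⟫_ℂ)
    (hGP : ∀ n, ∀ w z : lp (fun _ : (Fin 3 → ℤ) => EuclideanSpace ℂ (Fin 3)) 2,
      ⟪G w, cubeProj (n + K) z⟫_ℂ = ⟪G (cubeProj (n + K) w), z⟫_ℂ)
    (hG₁pos : ∀ x : lp (fun _ : (Fin 3 → ℤ) => EuclideanSpace ℂ (Fin 3)) 2, 0 ≤ re ⟪G₁ x, x⟫_ℂ)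
    {ω c m₂ M₁ : ℝ} (hc : 0 < c) (hm₂ : 0 < m₂) (hM₁ : 0 ≤ M₁)
    (hm₂' : ∀ x : lp (fun _ : (Fin 3 → ℤ) => EuclideanSpace ℂ (Fin 3)) 2, m₂ * ‖x‖ ^ 2 ≤ re ⟪G₂ x, x⟫_ℂ)
    (hM₁' : ∀ x : lp (fun _ : (Fin 3 → ℤ) => EuclideanSpace ℂ (Fin 3)) 2,
      re ⟪G₁ x, x⟫_ℂ ≤ M₁ * (eNormSq (-1) (⇑x)).toReal)
    {m M ω₁ : ℝ} (hm0 : 0 < m)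
    (hm : ∀ x : lp (fun _ : (Fin 3 → ℤ) => EuclideanSpace ℂ (Fin 3)) 2, m * ‖x‖ ^ 2 ≤ re ⟪G x, x⟫_ℂ)
    (hM : ∀ x : lp (fun _ : (Fin 3 → ℤ) => EuclideanSpace ℂ (Fin 3)) 2, re ⟪G x, x⟫_ℂ ≤ M * ‖x‖ ^ 2)
    (h₁ : ∀ n, ∀ w : lp (fun _ : (Fin 3 → ℤ) => EuclideanSpace ℂ (Fin 3)) 2,
      2 * re ⟪G₁ (cubeProj (n + K) w), linOp ν (mFourierCoeff (EuclideanSpace.complexify ∘ Torus.abcFlow A B C))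
        (fun j => (EuclideanSpace.proj j : EuclideanSpace ℂ (Fin 3) →L[ℂ] ℂ)) lerayCLM (cubeProj (n + K) w)⟫_ℂ +
        c * re ⟪G₂ (cubeProj (n + K) w), cubeProj (n + K) w⟫_ℂ ≤ 2 * ω * re ⟪G₁ (cubeProj (n + K) w), cubeProj (n + K) w⟫_ℂ)
    (h₂ : ∀ n, ∀ w : lp (fun _ : (Fin 3 → ℤ) => EuclideanSpace ℂ (Fin 3)) 2,
      re ⟪G₂ (cubeProj (n + K) w), linOp ν (mFourierCoeff (EuclideanSpace.complexify ∘ Torus.abcFlow A B C))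
        (fun j => (EuclideanSpace.proj j : EuclideanSpace ℂ (Fin 3) →L[ℂ] ℂ)) lerayCLM (cubeProj (n + K) w)⟫_ℂ ≤
        ω * re ⟪G₂ (cubeProj (n + K) w), cubeProj (n + K) w⟫_ℂ)
    (hL : ∀ n, ∀ w : lp (fun _ : (Fin 3 → ℤ) => EuclideanSpace ℂ (Fin 3)) 2,
      re ⟪G (cubeProj (n + K) w), linOp ν (mFourierCoeff (EuclideanSpace.complexify ∘ Torus.abcFlow A B C))
        (fun j => (EuclideanSpace.proj j : EuclideanSpace ℂ (Fin 3) →L[ℂ] ℂ)) lerayCLM (cubeProj (n + K) w)⟫_ℂ ≤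
        ω₁ * re ⟪G (cubeProj (n + K) w), cubeProj (n + K) w⟫_ℂ)
    (hμ₁ : μt ≤ ω₁) (hμ₂ : μt ≤ ω)
    (htail : ∀ n, ∀ q : lp (fun _ : (Fin 3 → ℤ) => EuclideanSpace ℂ (Fin 3)) 2, cubeProj (n + K) q = 0 →
      2 * μt * re ⟪G₁ q, q⟫_ℂ + c * re ⟪G₂ q, q⟫_ℂ ≤ 2 * ω * re ⟪G₁ q, q⟫_ℂ)
    {lam : ℝ} (hgap : ω < 2 * lam) (hlam : lam ≤ 0) (hrate : ω₁ ≤ lam)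
    {ε : ℝ} (hε : 0 < ε) (hseed : Real.sqrt (M / m) * ‖x‖ < ε)
    (hbasin : 4 * (Real.sqrt (M₁ / (c * m₂)) * (2 * ((Fintype.card (Fin 3) : ℝ) * (2 * Real.pi)) *
        Real.sqrt ((∑' l : Fin 3 → ℤ, ENNReal.ofReal (sobolevWeight (-2) l ^ 2)).toReal)) *
        Real.sqrt (Real.pi / (2 * lam - ω))) * ε < 1)
    {w : ℝ → lp (fun _ : (Fin 3 → ℤ) => EuclideanSpace ℂ (Fin 3)) 2} (hw : ContinuousOn w (Icc 0 T))
    (hw0 : w 0 = x)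
    (hw' : ∀ t ∈ Ioo 0 T, HasDerivAt w (nsField ν (mFourierCoeff (EuclideanSpace.complexify ∘ Torus.abcFlow A B C))
      (fun j => (EuclideanSpace.proj j : EuclideanSpace ℂ (Fin 3) →L[ℂ] ℂ)) lerayCLM (w t)) t)
    {Cw : ℝ} (hCw : 0 ≤ Cw)
    (hwdec : ∀ t ∈ Icc 0 T, ∀ k, ‖(w t : (Fin 3 → ℤ) → EuclideanSpace ℂ (Fin 3)) k‖ ≤
      Cw * sobolevWeight (-((Fintype.card (Fin 3) : ℝ) + 3)) k)
    (hwfix : ∀ t ∈ Icc 0 T, ∀ k, lerayCLM k ((w t : (Fin 3 → ℤ) → EuclideanSpace ℂ (Fin 3)) k) =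
      (w t : (Fin 3 → ℤ) → EuclideanSpace ℂ (Fin 3)) k)
    (hwreal : ∀ t ∈ Icc 0 T, ∀ (j : Fin 3) (k : Fin 3 → ℤ),
      (EuclideanSpace.proj j : EuclideanSpace ℂ (Fin 3) →L[ℂ] ℂ) ((w t : (Fin 3 → ℤ) → EuclideanSpace ℂ (Fin 3)) (-k)) =
        conj ((EuclideanSpace.proj j : EuclideanSpace ℂ (Fin 3) →L[ℂ] ℂ) ((w t : (Fin 3 → ℤ) → EuclideanSpace ℂ (Fin 3)) k)))
    (hwdiv : ∀ t ∈ Icc 0 T, ∀ k : Fin 3 → ℤ,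
      ∑ j, ((k j : ℤ) : ℂ) * (EuclideanSpace.proj j : EuclideanSpace ℂ (Fin 3) →L[ℂ] ℂ)
        ((w t : (Fin 3 → ℤ) → EuclideanSpace ℂ (Fin 3)) k) = 0) :
    ∀ t ∈ Icc 0 T, ‖w t‖ ≤ 2 * (ε * Real.exp (lam * t)) := by
  -- the Galerkin levels of the seed: constructed
  have hUreal : IsConjSymm (mFourierCoeff (EuclideanSpace.complexify ∘ Torus.abcFlow A B C)) :=
    (isConjSymm_iff_proj _).2 (abcHost_real A B C)
  have hxS : ∀ N, cubeProj N x ∈ levelSubspace N := fun N => by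
    have hz : x ∈ box (fun k => ‖(x : (Fin 3 → ℤ) → EuclideanSpace ℂ (Fin 3)) k‖)
        (fun j => (EuclideanSpace.proj j : EuclideanSpace ℂ (Fin 3) →L[ℂ] ℂ)) lerayCLM :=
      mem_box.2 ⟨fun k => le_rfl, hxfix, hxreal, hxdiv⟩
    have h := cubeProj_mem_box hz N
    exact ⟨lpProj_idem _ _, h.2.1, h.2.2.1, h.2.2.2⟩
  have hsol := fun n => exists_level_solution (ν := ν) hν.le (rapidDecay_abcHost A B C) hUreal (abcHost_div A B C)
    (n + K) (hxS (n + K))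
  choose u hu0 hu' hucont humem using hsol
  exact decay_two_nsField_of_levels K hν (rapidDecay_abcHost A B C) (abcHost_real A B C) (abcHost_div A B C)
    TransportGalerkinAbc.norm_proj_le isSelfAdjoint_lerayCLM norm_lerayCLM_le
    (tsum_sobolevWeight_neg_two_sq_lt_top (Fintype.card_fin 3).le) hT hxr hxfix hxreal hxdiv (u := u)
    (fun n t ht => (hu' n T t ht).continuousWithinAt)
    (fun n => hu0 n)
    (fun n t ht => hu' n T t ht)
    (fun n => hucont n T)
    (fun n t _ => (humem n t).1)
    (fun n t _ => (humem n t).2.1)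
    (fun n t _ => (humem n t).2.2.1)
    (fun n t _ => (humem n t).2.2.2)
    hG₁ hG₂ hG hG₁P hG₂P hGP hG₁pos hc hm₂ hM₁ hm₂' hM₁' hm0 hm hM h₁ h₂ hL hμ₁ hμ₂ htail hgap hlam hrate hε hseed
    hbasin hw hw0 hw' hCw hwdec hwfix hwreal hwdiv

end Summit.NavierStokesRegularity.FluidComputer.TransportGalerkinAbcKillFinal

end
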